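import Summits.CriticalPhenomena.PercolationContinuityZ3.Theses.PercNearOneGluingNoHeavy
import Summits.CriticalPhenomena.PercolationContinuityZ3.Theorems.PercNearOneGluingNoHeavyAllDimensions
import Literature.Probability.Percolation.KestenTheoremProofs
import Literature.Probability.Percolation.CriticalContinuityProofs
import Literature.Probability.Percolation.GrimmettMarstrandSlabLimit
import Literature.Probability.Percolation.PercolationProofs
import Literature.Barriers.CriticalPhenomena.SlabLimitUniformControlProofs

/-!
# Sanity lemmas for the definition cards of the slab-edge review runbook

HONEST FRAMING (slab cell `prim-slab-*`): bounded formalisation of a 1990 theorem; independent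
value; upgrades the primary's headline to all dimensions if one-cut lands.

The review runbook (`REVIEW-RUNBOOK.md`, ops-runbook generator `review-runbook/1`) for the three
headline theorems of the slab edge —
`Literature.Probability.Percolation.theta_slab_criticalProb_zd_eq_zero_holds` (C1, the edge:
`θ_{S_k}(p_c(ℤ^d)) = 0`), `Literature.Probability.Percolation.KozmaNitzan2024_thm6_holds` (C2,
Kozma–Nitzan Thm 6) and `percolationContinuity_of_noHeavyLowerTail` (C3, conditional glue) — has one
DEFINITION CARD per definition of ours in the transitive closure of the three statements (20 cards)
and asks, per card, for kernel-checked SANITY LEMMAS: (a) agreement with the Mathlib / textbook notion,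
(b) inhabitedness / non-vacuity witnesses, small computed instances.

This support file (`--supports stmt-CriticalPhenomena-4575`; it closes no item) adds the ones that are
NOT already declarations of the tree (those — e.g. `zdGraph_adj_iff`, `zero_mem_slab`,
`slab_subset_halfSpace`, `criticalProb_slab_lt_one`, `theta_bot`, `theta_eq_zero_of_finite`,
`criticalProb_mem_Icc`, `bondPercolation_cylinder`, `prodBernoulli_real_setOf_mem`, `openGraph_adj`,
`conjecture3_of_card_le`, and the generic companions in `RunbookPercolationSanity.lean` — are cited on
the cards by name).  Every line is a short consequence of the tree's percolation library or a small
computation, checked by the kernel against the SAME constants the headline theorems use.  Blocks: the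
slab statement instantiated (`d = 3`, `k = 1`) and its non-vacuity (`θ_{S_k}(1) = 1`, the evaluation
point `p_c(ℤ^d)` lies in `(0, 1)`); `KozmaNitzan2024_thm6` unfolded; the open statements
`NoHeavyLowerTail` / `NearOneGluing` / Conjecture 3 are the same terms across the two routes;
`PercolationContinuity` unfolded and TRUE at `d = 2` (Harris–Kesten, fully proved in the tree); `Site`,
`zdGraph` (concrete neighbours and non-neighbours); `slab`, `slabGraph`, `slabOrigin` (membership,
concrete points, nesting, induced adjacency); `theta` (range, monotonicity); `criticalProbI` (value
`1/2` at `d = 2`, bounds); `BondConfig`, `openCluster`, `openConn`, `percolatesAt` (unfoldings, finite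
graphs).
-/

namespace Summit.CriticalPhenomena.PercolationContinuityZ3.Theorems.SlabEdgeSanity

open Summit.CriticalPhenomena.PercolationContinuityZ3.Theses
open Literature.Probability.Percolation Literature.Probability.LatticeModels
open MeasureTheory

universe u

variable {V : Type u}

/-! ### `theta_slab_criticalProb_zd_eq_zero` (named statement, DISCHARGED by `…_holds`) -/

/-- Concrete instance `d = 3`, `k = 1`: `θ_{S_1}(p_c(ℤ³)) = 0`, obtained by APPLYING the named
statement (its binders instantiate as displayed on the card). -/
theorem theta_slab_three_one_criticalProbI :
    theta (slabGraph 3 1) (slabOrigin 3 1) (criticalProbI 3) = 0 :=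
  theta_slab_criticalProb_zd_eq_zero_holds 3 le_rfl 1 one_pos

/-- Non-vacuity of the slab statement: `θ_{S_k}` is NOT identically zero — at edge density `1` the
slab origin lies in an infinite open cluster almost surely, `θ_{S_k}(1) = 1` (`d ≥ 2`, every `k`: the
slab is infinite and its induced graph is connected, tree lemma `slabGraph_reachable`).  So
`θ_{S_k}(p_c(ℤ^d)) = 0` is a statement about the critical point, not about a degenerate graph.
(For `d ≥ 3` the tree even has `p_c(S_k) < 1`, `criticalProb_slab_lt_one`.) -/
theorem theta_slab_one (d : ℕ) [NeZero d] (hd : 2 ≤ d) (k : ℕ) :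
    theta (slabGraph d k) (slabOrigin d k) 1 = 1 := by
  obtain ⟨n, rfl⟩ : ∃ n, d = n + 1 := ⟨d - 1, by omega⟩
  haveI : NeZero n := ⟨by omega⟩
  have hinf : (slab (n + 1) k).Infinite :=
    (GMSlabLimit.gmHyperplane_infinite (n := n)).mono
      fun x (hx : x 0 = 0) => ⟨hx.ge, hx.trans_le (Nat.cast_nonneg k)⟩
  haveI : Infinite (slab (n + 1) k) := hinf.to_subtype
  have hmem : (slabGraph (n + 1) k).edgeSet ∈ percolatesAt (slabOrigin (n + 1) k) := by
    show (openCluster (slabGraph (n + 1) k).edgeSet (slabOrigin (n + 1) k)).Infinite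
    have hc : openCluster (slabGraph (n + 1) k).edgeSet (slabOrigin (n + 1) k) = Set.univ := by
      ext y
      simp only [openCluster, openGraph, SimpleGraph.fromEdgeSet_edgeSet, Set.mem_setOf_eq,
        Set.mem_univ, iff_true]
      exact Literature.Barriers.CriticalPhenomena.slabGraph_reachable (n + 1) k _ y
    rw [hc]
    exact Set.infinite_univ
  simp only [theta, bondPercolation, ProbabilityTheory.setBernoulli_one, measureReal_def,
    Measure.dirac_apply_of_mem hmem, ENNReal.toReal_one]

/-- The evaluation point of the slab statement is an interior point: `0 < p_c(ℤ^d) < 1` for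
`d ≥ 2` (so `θ_{S_k}(p_c(ℤ^d)) = 0` is neither the trivial `θ(0) = 0` nor excluded by
`θ_{S_k}(1) = 1`). -/
theorem criticalProbI_mem_Ioo {d : ℕ} (hd : 2 ≤ d) : (criticalProbI d : ℝ) ∈ Set.Ioo 0 1 :=
  ⟨criticalProb_zd_pos d (by omega), criticalProb_zd_lt_one hd⟩

/-! ### `KozmaNitzan2024_thm6` (named statement, DISCHARGED by `…_holds`) -/

/-- Theorem 6 unfolds to the displayed implication `Conjecture 3 → ∀ d ≥ 2, θ_{ℤ^d}(p_c) = 0`. -/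
theorem kozmaNitzan2024_thm6_iff :
    KozmaNitzan2024_thm6 ↔
      (KozmaNitzan2024_conjecture3 → ∀ d : ℕ, 2 ≤ d → PercolationContinuity d) :=
  Iff.rfl

/-! ### `NoHeavyLowerTail`, `NearOneGluing`, `KozmaNitzan2024_conjecture3` (OPEN statements) -/

/-- The hypothesis `h` of `percolationContinuity_of_noHeavyLowerTail` (route `PercNearOneGluingNoHeavy`)
is the SAME term as the sibling route `PercNearOneGluing`'s `NoHeavyLowerTail` (by `Iff.rfl`). -/
theorem noHeavyLowerTail_iff_sibling :
    PercNearOneGluingNoHeavy.NoHeavyLowerTail ↔ PercNearOneGluing.NoHeavyLowerTail :=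
  Iff.rfl

/-- The two routes' `NearOneGluing` are the same term (and both are Conjecture 3 verbatim, tree lemma
`nearOneGluing_iff_conjecture3`). -/
theorem nearOneGluing_iff_sibling :
    PercNearOneGluingNoHeavy.NearOneGluing ↔ PercNearOneGluing.NearOneGluing :=
  Iff.rfl

/-! ### `PercolationContinuity` -/

/-- `PercolationContinuity d` unfolds to `θ_{ℤ^d}(p_c(ℤ^d)) = 0` at the origin. -/
theorem percolationContinuity_iff (d : ℕ) :
    PercolationContinuity d ↔ theta (zdGraph d) (0 : Site d) (criticalProbI d) = 0 :=
  Iff.rfl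

/-- Non-vacuity in the first non-trivial dimension: `PercolationContinuity 2` HOLDS —
`θ_{ℤ²}(p_c) = 0` from Kesten's `p_c(ℤ²) = 1/2` and Harris' `θ(1/2) = 0`, both proved in the tree
(no named hypothesis is left). -/
theorem percolationContinuity_two_holds : PercolationContinuity 2 :=
  percolationContinuity_two kesten_criticalProb_Z2_holds harris_theta_half_holds

/-! ### `Site`, `zdGraph` -/

/-- A site of `ℤ^d` is a function `Fin d → ℤ`. -/
theorem site_eq (d : ℕ) : Site d = (Fin d → ℤ) := rfl

/-- Concrete neighbours in `ℤ²`: `(0,0) ∼ (0,1)`. -/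
theorem zdGraph_two_adj_example : (zdGraph 2).Adj ![0, 0] ![0, 1] := by
  decide

/-- Concrete non-neighbours in `ℤ²`: the diagonal pair `(0,0)`, `(1,1)` is NOT a bond. -/
theorem zdGraph_two_not_adj_diagonal : ¬ (zdGraph 2).Adj ![0, 0] ![1, 1] := by
  decide

/-- Concrete non-neighbours in `ℤ²`: `(0,0)` and `(0,2)` are NOT joined (only unit steps). -/
theorem zdGraph_two_not_adj_two_steps : ¬ (zdGraph 2).Adj ![0, 0] ![0, 2] := by
  decide

/-! ### `slab`, `slabGraph`, `slabOrigin` -/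

/-- Membership in the thick slab `S_k` is the displayed pair of inequalities on the first coordinate. -/
theorem mem_slab_iff (d : ℕ) [NeZero d] (k : ℕ) (x : Site d) :
    x ∈ slab d k ↔ 0 ≤ x 0 ∧ x 0 ≤ (k : ℤ) :=
  Iff.rfl

/-- Concrete point of `S_1 ⊂ ℤ³`: `(1, 5, -7)` (only the first coordinate is constrained). -/
theorem slab_three_one_mem_example : (![1, 5, -7] : Site 3) ∈ slab 3 1 := by
  simp [slab]

/-- Concrete non-point of `S_1 ⊂ ℤ³`: `(2, 0, 0)` (first coordinate too large). -/
theorem slab_three_one_not_mem_example : (![2, 0, 0] : Site 3) ∉ slab 3 1 := by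
  simp [slab]

/-- Concrete non-point of `S_1 ⊂ ℤ³`: `(-1, 0, 0)` (first coordinate negative). -/
theorem slab_three_one_not_mem_example' : (![-1, 0, 0] : Site 3) ∉ slab 3 1 := by
  simp [slab]

/-- Slabs are nested: `S_k ⊆ S_{k+1}`. -/
theorem slab_subset_slab_succ (d : ℕ) [NeZero d] (k : ℕ) : slab d k ⊆ slab d (k + 1) := by
  intro x hx
  simp only [slab, Set.mem_setOf_eq, Nat.cast_add, Nat.cast_one] at hx ⊢
  exact ⟨hx.1, by linarith [hx.2]⟩

/-- `slabGraph` is the INDUCED subgraph: two slab sites are joined iff they are lattice neighbours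
(no bond is added or removed inside the slab). -/
theorem slabGraph_adj_iff (d : ℕ) [NeZero d] (k : ℕ) (x y : slab d k) :
    (slabGraph d k).Adj x y ↔ (zdGraph d).Adj (x : Site d) (y : Site d) :=
  Iff.rfl

/-- The slab origin is the lattice origin. -/
theorem coe_slabOrigin (d : ℕ) [NeZero d] (k : ℕ) :
    ((slabOrigin d k : slab d k) : Site d) = 0 :=
  rfl

/-! ### `theta` -/

/-- `θ` is a probability: `0 ≤ θ`. -/
theorem theta_nonneg (G : SimpleGraph V) (x : V) (p : unitInterval) : 0 ≤ theta G x p :=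
  measureReal_nonneg

/-- `θ` is a probability: `θ ≤ 1`. -/
theorem theta_le_one (G : SimpleGraph V) (x : V) (p : unitInterval) : theta G x p ≤ 1 :=
  measureReal_le_one

/-- `θ_x` is non-decreasing in `p` (monotone coupling, tree theorem `theta_mono_holds`). -/
theorem theta_monotone [Countable V] (G : SimpleGraph V) (x : V) : Monotone (theta G x) :=
  theta_mono_holds G x

/-! ### `criticalProbI` -/

/-- Computed value: `p_c(ℤ²) = 1/2` (Kesten 1980, proved in the tree). -/
theorem criticalProbI_two : (criticalProbI 2 : ℝ) = 1 / 2 :=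
  kesten_criticalProb_Z2_holds

/-- `p_c(ℤ^d) > 0` for `d ≥ 1`. -/
theorem criticalProbI_pos {d : ℕ} (hd : 1 ≤ d) : 0 < (criticalProbI d : ℝ) :=
  criticalProb_zd_pos d hd

/-- `p_c(ℤ^d) ≥ 1/(2d)` for `d ≥ 1`. -/
theorem criticalProbI_ge {d : ℕ} (hd : 1 ≤ d) : 1 / (2 * d : ℝ) ≤ (criticalProbI d : ℝ) :=
  criticalProb_zd_ge d hd

/-- `p_c(ℤ^d) < 1` for `d ≥ 2`. -/
theorem criticalProbI_lt_one {d : ℕ} (hd : 2 ≤ d) : (criticalProbI d : ℝ) < 1 :=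
  criticalProb_zd_lt_one hd

/-! ### `BondConfig`, `openCluster`, `openConn`, `percolatesAt` -/

/-- A bond configuration is a set of (open) unordered pairs. -/
theorem bondConfig_eq (W : Type u) : BondConfig W = Set (Sym2 W) := rfl

/-- `C(x)` is the set of vertices reachable from `x` by open bonds. -/
theorem mem_openCluster_iff (ω : BondConfig V) (x y : V) :
    y ∈ openCluster ω x ↔ (openGraph ω).Reachable x y :=
  Iff.rfl

/-- The event `{x ↔ y}` is `{ω | y ∈ C_ω(x)}`. -/
theorem mem_openConn_iff_mem_openCluster (ω : BondConfig V) (x y : V) :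
    ω ∈ openConn x y ↔ y ∈ openCluster ω x :=
  Iff.rfl

/-- `{|C(x)| = ∞}` unfolds to "the open cluster of `x` is an infinite set". -/
theorem mem_percolatesAt_iff (ω : BondConfig V) (x : V) :
    ω ∈ percolatesAt x ↔ (openCluster ω x).Infinite :=
  Iff.rfl

/-- On a finite vertex set the percolation event is EMPTY (consistent with `θ ≡ 0` there,
tree lemma `theta_eq_zero_of_finite`). -/
theorem percolatesAt_eq_empty_of_finite [Finite V] (x : V) :
    (percolatesAt x : Set (BondConfig V)) = ∅ :=
  Set.eq_empty_of_forall_notMem fun _ h => h (Set.toFinite _)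

end Summit.CriticalPhenomena.PercolationContinuityZ3.Theorems.SlabEdgeSanity
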